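import Summits.HodgeConjecture.HodgeCM.PerL34.SeesawTorus_1

/-! PORT of `HodgeCM/PerL34/SeesawTorus.lean` (HodgeCMPerL run 82) — part 2: continuation of `Summits.HodgeConjecture.HodgeCM.PerL34.SeesawTorus_1` (split at a top-level declaration boundary by port_pkg.py; scope re-opened below; declarations unchanged). -/

-- port_pkg: scope re-opened for this part (file-level context, then the namespace/section stack open at the cut)
set_option autoImplicit false
noncomputable section
open MeasureTheory Topology Set Function
namespace NumberField
namespace SeesawTorus
section Quotient
variable (K L : Type) [Field K] [Field L] [NumberField L] [Algebra K L] [FiniteDimensional K L]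
variable {K L}
/-- (Ported verbatim from the HodgeCMPerL package; no docstring in the source.) -/
@[simp] theorem quotSnd_quotInl (q : relNormOneIdeles K L ⧸ relNormOneRat K L) : quotSnd K L (quotInl K L q) = 1 := by
  induction q using QuotientGroup.induction_on; rfl
/-- (Ported verbatim from the HodgeCMPerL package; no docstring in the source.) -/
@[simp] theorem quotFst_quotInr (q : relNormOneIdeles K L ⧸ relNormOneRat K L) : quotFst K L (quotInr K L q) = 1 := by
  induction q using QuotientGroup.induction_on; rfl

/-- (Ported verbatim from the HodgeCMPerL package; no docstring in the source.) -/
theorem quotInl_mul_quotInr (t : SeesawTorus K L) :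
    quotInl K L (QuotientGroup.mk (fst K L t)) * quotInr K L (QuotientGroup.mk (snd K L t)) = QuotientGroup.mk t := by
  rw [quotInl_mk, quotInr_mk, ← QuotientGroup.mk_mul, inl_mul_inr, mk_eq_fst_snd]

/-- (Ported verbatim from the HodgeCMPerL package; no docstring in the source.) -/
theorem quotInl_quotFst_mul_quotInr_quotSnd (q : SeesawTorus K L ⧸ rat K L) :
    quotInl K L (quotFst K L q) * quotInr K L (quotSnd K L q) = q := by
  induction q using QuotientGroup.induction_on
  exact quotInl_mul_quotInr _

variable (K L)

/-- (Ported verbatim from the HodgeCMPerL package; no docstring in the source.) -/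
theorem continuous_quotFst : Continuous (quotFst K L) :=
  (QuotientGroup.isQuotientMap_mk _).continuous_iff.mpr (QuotientGroup.continuous_mk.comp (continuous_fst K L))
/-- (Ported verbatim from the HodgeCMPerL package; no docstring in the source.) -/
theorem continuous_quotSnd : Continuous (quotSnd K L) :=
  (QuotientGroup.isQuotientMap_mk _).continuous_iff.mpr (QuotientGroup.continuous_mk.comp (continuous_snd K L))
/-- (Ported verbatim from the HodgeCMPerL package; no docstring in the source.) -/
theorem continuous_quotInl : Continuous (quotInl K L) :=
  (QuotientGroup.isQuotientMap_mk _).continuous_iff.mpr (QuotientGroup.continuous_mk.comp (continuous_inl K L))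
/-- (Ported verbatim from the HodgeCMPerL package; no docstring in the source.) -/
theorem continuous_quotInr : Continuous (quotInr K L) :=
  (QuotientGroup.isQuotientMap_mk _).continuous_iff.mpr (QuotientGroup.continuous_mk.comp (continuous_inr K L))

/-- `[T] ≃* [U(W₁)] × [U(W₂)]` as groups. -/
def quotMulEquiv : SeesawTorus K L ⧸ rat K L ≃*
    (relNormOneIdeles K L ⧸ relNormOneRat K L) × (relNormOneIdeles K L ⧸ relNormOneRat K L) where
  toFun q := (quotFst K L q, quotSnd K L q)
  invFun p := quotInl K L p.1 * quotInr K L p.2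
  left_inv q := quotInl_quotFst_mul_quotInr_quotSnd q
  right_inv p := by
    obtain ⟨p₁, p₂⟩ := p
    induction p₁ using QuotientGroup.induction_on with | H a => ?_
    induction p₂ using QuotientGroup.induction_on with | H b => ?_
    change (fun q => (quotFst K L q, quotSnd K L q))
      (quotInl K L (QuotientGroup.mk a) * quotInr K L (QuotientGroup.mk b)) = _
    rw [show quotInl K L (QuotientGroup.mk a) * quotInr K L (QuotientGroup.mk b) = QuotientGroup.mk (mk K L a b) from
      quotInl_mul_quotInr (mk K L a b)]
    rfl
  map_mul' q q' := by
    simp only [map_mul, Prod.mk_mul_mk]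

/-- (Ported verbatim from the HodgeCMPerL package; no docstring in the source.) -/
@[simp] theorem quotMulEquiv_apply (q : SeesawTorus K L ⧸ rat K L) :
    quotMulEquiv K L q = (quotFst K L q, quotSnd K L q) := rfl

/-- (Ported verbatim from the HodgeCMPerL package; no docstring in the source.) -/
@[simp] theorem quotMulEquiv_symm_apply (p : (relNormOneIdeles K L ⧸ relNormOneRat K L) × (relNormOneIdeles K L ⧸ relNormOneRat K L)) :
    (quotMulEquiv K L).symm p = quotInl K L p.1 * quotInr K L p.2 := rfl

/-- (Ported verbatim from the HodgeCMPerL package; no docstring in the source.) -/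
theorem continuous_quotMulEquiv : Continuous (quotMulEquiv K L) :=
  (continuous_quotFst K L).prodMk (continuous_quotSnd K L)

/-- (Ported verbatim from the HodgeCMPerL package; no docstring in the source.) -/
theorem continuous_quotMulEquiv_symm : Continuous (quotMulEquiv K L).symm :=
  ((continuous_quotInl K L).comp _root_.continuous_fst).mul ((continuous_quotInr K L).comp _root_.continuous_snd)

/-- **`[T] ≃ₜ* [U(W₁)] × [U(W₂)]`** as topological groups (PerL l. 335 "`[T] = [U(W₁)]×[U(W₂)]`"). -/
def quotEquiv : SeesawTorus K L ⧸ rat K L ≃ₜ*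
    (relNormOneIdeles K L ⧸ relNormOneRat K L) × (relNormOneIdeles K L ⧸ relNormOneRat K L) :=
  { quotMulEquiv K L with
    continuous_toFun := continuous_quotMulEquiv K L
    continuous_invFun := continuous_quotMulEquiv_symm K L }

/-- (Ported verbatim from the HodgeCMPerL package; no docstring in the source.) -/
@[simp] theorem quotEquiv_apply (q : SeesawTorus K L ⧸ rat K L) :
    quotEquiv K L q = (quotFst K L q, quotSnd K L q) := rfl

/-- (Ported verbatim from the HodgeCMPerL package; no docstring in the source.) -/
theorem quotEquiv_mk (t : SeesawTorus K L) :
    quotEquiv K L (QuotientGroup.mk t) = (QuotientGroup.mk (fst K L t), QuotientGroup.mk (snd K L t)) := rfl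

/-- (Ported verbatim from the HodgeCMPerL package; no docstring in the source.) -/
@[simp] theorem quotEquiv_symm_apply
    (p : (relNormOneIdeles K L ⧸ relNormOneRat K L) × (relNormOneIdeles K L ⧸ relNormOneRat K L)) :
    (quotEquiv K L).symm p = quotInl K L p.1 * quotInr K L p.2 := rfl

/-- **`[T]` is compact** (from pv11-g4 `compactSpace_relNormOneQuot` for each factor). -/
instance compactSpace_quot : CompactSpace (SeesawTorus K L ⧸ rat K L) :=
  (quotEquiv K L).toHomeomorph.symm.compactSpace

/-- `dt` on `[T]`: the Haar measure normalised by `vol [T] = 1`. -/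
def probHaarQuot : Measure (SeesawTorus K L ⧸ rat K L) := Measure.haarMeasure ⊤

/-- (Ported verbatim from the HodgeCMPerL package; no docstring in the source.) -/
instance isHaarMeasure_probHaarQuot : (probHaarQuot K L).IsHaarMeasure := by
  unfold probHaarQuot; infer_instance

/-- (Ported verbatim from the HodgeCMPerL package; no docstring in the source.) -/
instance isProbabilityMeasure_probHaarQuot : IsProbabilityMeasure (probHaarQuot K L) := by
  refine ⟨?_⟩
  have h := Measure.haarMeasure_self (G := SeesawTorus K L ⧸ rat K L) (K₀ := ⊤)
  rwa [TopologicalSpace.PositiveCompacts.coe_top] at h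

/-- (Ported verbatim from the HodgeCMPerL package; no docstring in the source.) -/
instance isOpenPosMeasure_probHaarQuot : (probHaarQuot K L).IsOpenPosMeasure := inferInstance

/-- (Ported verbatim from the HodgeCMPerL package; no docstring in the source.) -/
instance isMulLeftInvariant_probHaarQuot : (probHaarQuot K L).IsMulLeftInvariant := inferInstance

/-- (Ported verbatim from the HodgeCMPerL package; no docstring in the source.) -/
instance isMulRightInvariant_probHaarQuot : (probHaarQuot K L).IsMulRightInvariant := inferInstance

/-- (Ported verbatim from the HodgeCMPerL package; no docstring in the source.) -/
theorem probHaarQuot_univ : probHaarQuot K L univ = 1 := measure_univ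

/-- Uniqueness: `dt` is THE Haar probability measure on `[T]`. -/
theorem eq_probHaarQuot (μ : Measure (SeesawTorus K L ⧸ rat K L)) [μ.IsHaarMeasure] [IsProbabilityMeasure μ] :
    μ = probHaarQuot K L :=
  Measure.isHaarMeasure_eq_of_isProbabilityMeasure _ _

/-- The pv11-g4 `AutomorphicTorusDatum` of the seesaw torus (group / measure block of `SupplyBridgeA` shape):
`A := T(𝔸)`, `rat := T(L₀)`, `ν := dt`; every instance field inferred. -/
def torusDatum : AutomorphicTorusDatum where
  A := SeesawTorus K L
  rat := rat K L
  ν := probHaarQuot K L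

/-- (Ported verbatim from the HodgeCMPerL package; no docstring in the source.) -/
theorem torusDatum_mass_one : (torusDatum K L).ν univ = 1 := probHaarQuot_univ K L

end Quotient

/-! ## §5  A Haar measure `ν_T` on `T(𝔸)` and a fundamental domain of `T(L₀)` -/

section Haar

variable (K L : Type) [Field K] [Field L] [NumberField L] [Algebra K L] [FiniteDimensional K L]

/-- `ν_T`: a Haar measure on `T(𝔸)`. -/
def haar : Measure (SeesawTorus K L) := Measure.haar

/-- (Ported verbatim from the HodgeCMPerL package; no docstring in the source.) -/
instance isHaarMeasure_haar : (haar K L).IsHaarMeasure := by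
  unfold haar; infer_instance

/-- (Ported verbatim from the HodgeCMPerL package; no docstring in the source.) -/
instance isMulRightInvariant_haar : (haar K L).IsMulRightInvariant := inferInstance

/-- (Ported verbatim from the HodgeCMPerL package; no docstring in the source.) -/
instance isMulLeftInvariant_haar : (haar K L).IsMulLeftInvariant := inferInstance

/-- (Ported verbatim from the HodgeCMPerL package; no docstring in the source.) -/
instance isOpenPosMeasure_haar : (haar K L).IsOpenPosMeasure := inferInstance

/-- (Ported verbatim from the HodgeCMPerL package; no docstring in the source.) -/
instance isFiniteMeasureOnCompacts_haar : IsFiniteMeasureOnCompacts (haar K L) := inferInstance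

/-- **A fundamental domain of `T(L₀)` in `T(𝔸)`** for the right action, measurable, relatively compact, of finite
measure — for EVERY measure finite on compacts (pv09-g4 `exists_isFundamentalDomain_op_finite'`; its hypotheses
`DiscreteTopology (rat K L)`, `Countable (rat K L)`, `LocallyCompactSpace (SeesawTorus K L)`,
`CompactSpace (SeesawTorus K L ⧸ rat K L)` are §3–§4). -/
theorem exists_isFundamentalDomain_rat_op (μ : Measure (SeesawTorus K L)) [IsFiniteMeasureOnCompacts μ] :
    ∃ 𝓕 : Set (SeesawTorus K L), MeasurableSet 𝓕 ∧ IsFundamentalDomain (rat K L).op 𝓕 μ ∧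
      IsCompact (closure 𝓕) ∧ μ 𝓕 < ⊤ :=
  HodgeCM.PerL34.DiscreteFD.exists_isFundamentalDomain_op_finite' (rat K L) μ

/-- The exact form: one point in every `T(L₀)`-orbit (a fundamental domain for every measure at once). -/
theorem exists_fundamentalDomain_rat_exact :
    ∃ 𝓕 : Set (SeesawTorus K L), MeasurableSet 𝓕 ∧ IsCompact (closure 𝓕) ∧
      ∀ t : SeesawTorus K L, ∃! γ : (rat K L).op, γ • t ∈ 𝓕 :=
  HodgeCM.PerL34.DiscreteFD.exists_fundamentalDomain_op_relCompact' (rat K L)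

/-- A chosen fundamental domain `𝓕_T` of `T(L₀)` in `T(𝔸)` for `ν_T`. -/
def fundamentalDomain : Set (SeesawTorus K L) := (exists_isFundamentalDomain_rat_op K L (haar K L)).choose

/-- (Ported verbatim from the HodgeCMPerL package; no docstring in the source.) -/
theorem measurableSet_fundamentalDomain : MeasurableSet (fundamentalDomain K L) :=
  (exists_isFundamentalDomain_rat_op K L (haar K L)).choose_spec.1

/-- (Ported verbatim from the HodgeCMPerL package; no docstring in the source.) -/
theorem isFundamentalDomain_fundamentalDomain : IsFundamentalDomain (rat K L).op (fundamentalDomain K L) (haar K L) :=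
  (exists_isFundamentalDomain_rat_op K L (haar K L)).choose_spec.2.1

/-- (Ported verbatim from the HodgeCMPerL package; no docstring in the source.) -/
theorem isCompact_closure_fundamentalDomain : IsCompact (closure (fundamentalDomain K L)) :=
  (exists_isFundamentalDomain_rat_op K L (haar K L)).choose_spec.2.2.1

/-- (Ported verbatim from the HodgeCMPerL package; no docstring in the source.) -/
theorem haar_fundamentalDomain_lt_top : haar K L (fundamentalDomain K L) < ⊤ :=
  (exists_isFundamentalDomain_rat_op K L (haar K L)).choose_spec.2.2.2

/-- The quotient-model measure `map π (ν_T|𝓕_T)` on `[T]` is finite (its total mass is `ν_T(𝓕_T)`). -/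
theorem map_restrict_fundamentalDomain_univ :
    Measure.map (QuotientGroup.mk : SeesawTorus K L → SeesawTorus K L ⧸ rat K L)
      ((haar K L).restrict (fundamentalDomain K L)) univ = haar K L (fundamentalDomain K L) := by
  rw [Measure.map_apply QuotientGroup.continuous_mk.measurable MeasurableSet.univ, preimage_univ,
    Measure.restrict_apply_univ]

end Haar

end SeesawTorus

/-! ## §6  `T(L₀ ⊗ ℝ) = U(W₁)(L₀⊗ℝ) × U(W₂)(L₀⊗ℝ)`, its probability Haar measure, `ιc` and `cl` -/

/-- **`T(L₀ ⊗ ℝ)`** for the CM extension `L/L⁺`: the product of two copies of the compact torus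
`U(W_j)(L₀ ⊗ ℝ) = unitaryLineArchTorus L ≅ ∏_{w∣∞} U(1)`, as a type synonym with the Borel σ-algebra. -/
def SeesawArchTorus (L : Type) [Field L] [NumberField L] [IsCMField L] : Type :=
  unitaryLineArchTorus L × unitaryLineArchTorus L

namespace SeesawArchTorus

variable (L : Type) [Field L] [NumberField L] [IsCMField L]

/-- (Ported verbatim from the HodgeCMPerL package; no docstring in the source.) -/
instance instCommGroup : CommGroup (SeesawArchTorus L) :=
  inferInstanceAs (CommGroup (unitaryLineArchTorus L × unitaryLineArchTorus L))

/-- (Ported verbatim from the HodgeCMPerL package; no docstring in the source.) -/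
instance instTopologicalSpace : TopologicalSpace (SeesawArchTorus L) :=
  inferInstanceAs (TopologicalSpace (unitaryLineArchTorus L × unitaryLineArchTorus L))

/-- (Ported verbatim from the HodgeCMPerL package; no docstring in the source.) -/
instance instIsTopologicalGroup : IsTopologicalGroup (SeesawArchTorus L) :=
  inferInstanceAs (IsTopologicalGroup (unitaryLineArchTorus L × unitaryLineArchTorus L))

/-- (Ported verbatim from the HodgeCMPerL package; no docstring in the source.) -/
instance instT2Space : T2Space (SeesawArchTorus L) :=
  inferInstanceAs (T2Space (unitaryLineArchTorus L × unitaryLineArchTorus L))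

/-- `T(L₀ ⊗ ℝ)` is compact (pv11-g4 `compactSpace_unitaryLineArchTorus`). -/
instance instCompactSpace : CompactSpace (SeesawArchTorus L) :=
  inferInstanceAs (CompactSpace (unitaryLineArchTorus L × unitaryLineArchTorus L))

/-- (Ported verbatim from the HodgeCMPerL package; no docstring in the source.) -/
instance instMeasurableSpace : MeasurableSpace (SeesawArchTorus L) := borel _

/-- (Ported verbatim from the HodgeCMPerL package; no docstring in the source.) -/
instance instBorelSpace : BorelSpace (SeesawArchTorus L) := ⟨rfl⟩

/-- (Ported verbatim from the HodgeCMPerL package; no docstring in the source.) -/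
instance instNonempty : Nonempty (SeesawArchTorus L) := ⟨1⟩

/-- `(t₁, t₂) ∈ T(L₀ ⊗ ℝ)`. -/
def mk (t₁ t₂ : unitaryLineArchTorus L) : SeesawArchTorus L := (t₁, t₂)

/-- The two projections and inclusions. -/
def fst : SeesawArchTorus L →* unitaryLineArchTorus L := MonoidHom.fst _ _
/-- (Ported verbatim from the HodgeCMPerL package; no docstring in the source.) -/
def snd : SeesawArchTorus L →* unitaryLineArchTorus L := MonoidHom.snd _ _
/-- (Ported verbatim from the HodgeCMPerL package; no docstring in the source.) -/
def inl : unitaryLineArchTorus L →* SeesawArchTorus L := MonoidHom.inl _ _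
/-- (Ported verbatim from the HodgeCMPerL package; no docstring in the source.) -/
def inr : unitaryLineArchTorus L →* SeesawArchTorus L := MonoidHom.inr _ _

variable {L} in
/-- (Ported verbatim from the HodgeCMPerL package; no docstring in the source.) -/
@[simp] theorem fst_mk (t₁ t₂ : unitaryLineArchTorus L) : fst L (mk L t₁ t₂) = t₁ := rfl
variable {L} in
/-- (Ported verbatim from the HodgeCMPerL package; no docstring in the source.) -/
@[simp] theorem snd_mk (t₁ t₂ : unitaryLineArchTorus L) : snd L (mk L t₁ t₂) = t₂ := rfl
variable {L} in
/-- (Ported verbatim from the HodgeCMPerL package; no docstring in the source.) -/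
theorem mk_fst_snd (t : SeesawArchTorus L) : mk L (fst L t) (snd L t) = t := rfl
variable {L} in
/-- (Ported verbatim from the HodgeCMPerL package; no docstring in the source.) -/
theorem inl_mul_inr (t₁ t₂ : unitaryLineArchTorus L) : inl L t₁ * inr L t₂ = mk L t₁ t₂ :=
  Prod.ext (mul_one t₁) (one_mul t₂)

/-- The probability Haar measure on `T(L₀ ⊗ ℝ)`. -/
def probHaar : Measure (SeesawArchTorus L) := Measure.haarMeasure ⊤

/-- (Ported verbatim from the HodgeCMPerL package; no docstring in the source.) -/
instance isHaarMeasure_probHaar : (probHaar L).IsHaarMeasure := by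
  unfold probHaar; infer_instance

/-- (Ported verbatim from the HodgeCMPerL package; no docstring in the source.) -/
instance isProbabilityMeasure_probHaar : IsProbabilityMeasure (probHaar L) := by
  refine ⟨?_⟩
  have h := Measure.haarMeasure_self (G := SeesawArchTorus L) (K₀ := ⊤)
  rwa [TopologicalSpace.PositiveCompacts.coe_top] at h

/-- (Ported verbatim from the HodgeCMPerL package; no docstring in the source.) -/
instance isMulLeftInvariant_probHaar : (probHaar L).IsMulLeftInvariant := inferInstance

/-- (Ported verbatim from the HodgeCMPerL package; no docstring in the source.) -/
instance isMulRightInvariant_probHaar : (probHaar L).IsMulRightInvariant := inferInstance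

/-- **`ιc : T(L₀ ⊗ ℝ) →* T(𝔸)`**, the archimedean components `((t₁,1),(t₂,1))` (pv11-g4 `relNormOneInfToIdeles` on
each factor). -/
def toAdeles : SeesawArchTorus L →* SeesawTorus (maximalRealSubfield L) L :=
  MonoidHom.prodMap (relNormOneInfToIdeles (maximalRealSubfield L) L) (relNormOneInfToIdeles (maximalRealSubfield L) L)

variable {L} in
/-- (Ported verbatim from the HodgeCMPerL package; no docstring in the source.) -/
theorem toAdeles_mk (t₁ t₂ : unitaryLineArchTorus L) :
    toAdeles L (mk L t₁ t₂) = SeesawTorus.mk _ L (relNormOneInfToIdeles _ L t₁) (relNormOneInfToIdeles _ L t₂) := rfl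

variable {L} in
/-- (Ported verbatim from the HodgeCMPerL package; no docstring in the source.) -/
@[simp] theorem fst_toAdeles (t : SeesawArchTorus L) :
    SeesawTorus.fst _ L (toAdeles L t) = relNormOneInfToIdeles _ L (fst L t) := rfl

variable {L} in
/-- (Ported verbatim from the HodgeCMPerL package; no docstring in the source.) -/
@[simp] theorem snd_toAdeles (t : SeesawArchTorus L) :
    SeesawTorus.snd _ L (toAdeles L t) = relNormOneInfToIdeles _ L (snd L t) := rfl

/-- (Ported verbatim from the HodgeCMPerL package; no docstring in the source.) -/
theorem continuous_toAdeles : Continuous (toAdeles L) :=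
  ((continuous_relNormOneInfToIdeles _ L).comp _root_.continuous_fst).prodMk
    ((continuous_relNormOneInfToIdeles _ L).comp _root_.continuous_snd)

/-- (Ported verbatim from the HodgeCMPerL package; no docstring in the source.) -/
theorem toAdeles_injective : Injective (toAdeles L) := by
  intro a b h
  exact Prod.ext (relNormOneInfToIdeles_injective _ L (congrArg (SeesawTorus.fst _ L) h))
    (relNormOneInfToIdeles_injective _ L (congrArg (SeesawTorus.snd _ L) h))

/-- **`cl = π ∘ ιc : T(L₀ ⊗ ℝ) → [T]`**. -/
def toQuot : SeesawArchTorus L →* SeesawTorus (maximalRealSubfield L) L ⧸ SeesawTorus.rat (maximalRealSubfield L) L :=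
  (QuotientGroup.mk' _).comp (toAdeles L)

variable {L} in
/-- (Ported verbatim from the HodgeCMPerL package; no docstring in the source.) -/
theorem toQuot_apply (t : SeesawArchTorus L) : toQuot L t = QuotientGroup.mk (toAdeles L t) := rfl

/-- (Ported verbatim from the HodgeCMPerL package; no docstring in the source.) -/
theorem continuous_toQuot : Continuous (toQuot L) := QuotientGroup.continuous_mk.comp (continuous_toAdeles L)

variable {L} in
/-- (Ported verbatim from the HodgeCMPerL package; no docstring in the source.) -/
@[simp] theorem quotFst_toQuot (t : SeesawArchTorus L) :
    SeesawTorus.quotFst _ L (toQuot L t) = relNormOneInfToQuot _ L (fst L t) := rfl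

variable {L} in
/-- (Ported verbatim from the HodgeCMPerL package; no docstring in the source.) -/
@[simp] theorem quotSnd_toQuot (t : SeesawArchTorus L) :
    SeesawTorus.quotSnd _ L (toQuot L t) = relNormOneInfToQuot _ L (snd L t) := rfl

variable {L} in
/-- (Ported verbatim from the HodgeCMPerL package; no docstring in the source.) -/
theorem toQuot_inl (t : unitaryLineArchTorus L) :
    toQuot L (inl L t) = SeesawTorus.quotInl _ L (relNormOneInfToQuot _ L t) := by
  have h : toAdeles L (inl L t) = SeesawTorus.inl _ L (relNormOneInfToIdeles _ L t) :=
    Prod.ext rfl (by change relNormOneInfToIdeles _ L 1 = 1; exact map_one _)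
  rw [toQuot_apply, h, relNormOneInfToQuot_apply, SeesawTorus.quotInl_mk]

variable {L} in
/-- (Ported verbatim from the HodgeCMPerL package; no docstring in the source.) -/
theorem toQuot_inr (t : unitaryLineArchTorus L) :
    toQuot L (inr L t) = SeesawTorus.quotInr _ L (relNormOneInfToQuot _ L t) := by
  have h : toAdeles L (inr L t) = SeesawTorus.inr _ L (relNormOneInfToIdeles _ L t) :=
    Prod.ext (by change relNormOneInfToIdeles _ L 1 = 1; exact map_one _) rfl
  rw [toQuot_apply, h, relNormOneInfToQuot_apply, SeesawTorus.quotInr_mk]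

/-! ## §7  The typed weight `w = archWeight m₁ ⊠ archWeight m₂` of `T(L₀ ⊗ ℝ)` -/

/-- **The weight `w` of `T(L₀ ⊗ ℝ)` of type `(m₁, m₂)`**: `(t₁, t₂) ↦ archWeight m₁ t₁ · archWeight m₂ t₂` — the
archimedean component `χ_{12,∞} = χ′_{1,∞} ⊠ χ′_{2,∞}` of a character `χ₁₂ = χ′₁ ⊠ χ′₂` of forced types. -/
def weight (m₁ m₂ : InfinitePlace L → ℤ) : SeesawArchTorus L →* ℂ :=
  MonoidHom.coprod (archWeight L m₁) (archWeight L m₂)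

variable {L} in
/-- (Ported verbatim from the HodgeCMPerL package; no docstring in the source.) -/
theorem weight_apply (m₁ m₂ : InfinitePlace L → ℤ) (t : SeesawArchTorus L) :
    weight L m₁ m₂ t = archWeight L m₁ (fst L t) * archWeight L m₂ (snd L t) := rfl

variable {L} in
/-- (Ported verbatim from the HodgeCMPerL package; no docstring in the source.) -/
@[simp] theorem weight_mk (m₁ m₂ : InfinitePlace L → ℤ) (t₁ t₂ : unitaryLineArchTorus L) :
    weight L m₁ m₂ (mk L t₁ t₂) = archWeight L m₁ t₁ * archWeight L m₂ t₂ := rfl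

variable {L} in
/-- (Ported verbatim from the HodgeCMPerL package; no docstring in the source.) -/
@[simp] theorem weight_inl (m₁ m₂ : InfinitePlace L → ℤ) (t : unitaryLineArchTorus L) :
    weight L m₁ m₂ (inl L t) = archWeight L m₁ t := by
  rw [weight_apply]; change archWeight L m₁ t * archWeight L m₂ 1 = _; rw [map_one, mul_one]


-- port_pkg: scope closed for this part
end SeesawArchTorus
end NumberField
end
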